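import Summits.ValiantsHypothesis.ValiantsHypothesis.Theorems.KPlusLogSqLawTropicalBNewtonPolygon

/-!
# Route «KPlusLogSqLaw», crux `TropicalB` (stmt-ValiantsHypothesis-19771) — the RATCHET law for dominant chains:
# steps with equal slope increment have strictly increasing valuation increments (design-level form of `NewtonPolygon.cross_lt`)

HONEST FRAMING.  Helper lemmas toward the registered stub `stub_tropThin` of `Cruxes/TropicalB/Lines/birth.lean` (crux
`Summit.ValiantsHypothesis.ValiantsHypothesis.Theses.KPlusLogSqLaw.TropicalB`, item `stmt-ValiantsHypothesis-19771`, route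
`KPlusLogSqLaw`, DRAFT; cell `pub-symmetroid`, seat val-sym-trop-p1 g2).  Design-level, `Fin`-indexed forms of the abstract
lattice-chain facts of `…TropicalBLatticeChain` (`cross_lt`, `edge_injOn`), stated directly on a chain
`p : Fin (n+1) → (σ, λ)` of dominant terms at strictly increasing integer slopes `θ` (the shape of `TropRow` / `TropRootLawAt`), so
that design seats can cite them without the `ℕ` re-indexing:

* `NewtonPolygon.ratchet` — for steps `k < k'`: `Δcst k · Δsl k' < Δcst k' · Δsl k` (edge slopes of the Newton polygon strictly
  increase), where `Δsl k = sl (p k.succ) − sl (p k.castSucc)` and `Δcst k = cst (p k.succ) − cst (p k.castSucc)`;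
* `NewtonPolygon.ratchet_of_sl_eq` — **RATCHET**: if two steps `k < k'` have the same slope increment then `Δcst k < Δcst k'`.  In a
  scale-separated («lex») design all unit steps of the fastest digit have the same slope increment `d₁ − d₀`, so their prices strictly
  increase along the WHOLE chain, across every carry (SHIFT-THREE's `price(p,b) = L·p + 2(b+1)` is exactly such a ratchet); a class switch
  `l → l'` at entry `e` has price `v e l' − v e l`, so switch steps of one type `(l, l')` occur in strictly increasing order of price and
  each entry's switch is used at most once (cf. `exchange_fresh`, val-sym-trop-p5);
* `NewtonPolygon.step_ne` — distinct steps have distinct edge vectors `(Δsl, Δcst)` (design-level `edge_injOn`).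

Nothing here bears on `TropicalB` / `KPlusLogSqLaw` in the window, on `Lifting`, DoorA26 / DoorA34, `MatrixDescartes`
(`stmt-ValiantsHypothesis-18050`) or VP ≠ VNP.  [folklore: convexity of the Newton polygon]
-/

-- `Summit.ValiantsHypothesis.ValiantsHypothesis.…` repeats a component by the D-0017 layout
-- (single-conjunct summit), which the `dupNamespace` linter flags; the name is mandated.
set_option linter.dupNamespace false
set_option autoImplicit false

namespace Summit.ValiantsHypothesis.ValiantsHypothesis.Theorems.KPlusLogSqLaw

open Summit.ValiantsHypothesis.ValiantsHypothesis.Theorems.MatrixDescartes.Negative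
open scoped BigOperators
open Finset

namespace NewtonPolygon

variable {m K : ℕ} (d : Fin K → ℕ) (v ε : Fin m → Fin m → Fin K → ℤ)

/-- The slope increment of every step of a dominant chain is positive (design-level, `Fin`-indexed). [folklore] -/
theorem sl_step_pos {n : ℕ} (θ : Fin (n + 1) → ℤ) (p : Fin (n + 1) → Equiv.Perm (Fin m) × (Fin m → Fin K))
    (hθ : StrictMono θ) (hdom : ∀ k, IsDominant d v ε (θ k) (p k)) (hne : ∀ k : Fin n, p k.castSucc ≠ p k.succ) (k : Fin n) :
    0 < IntervalOpt.sl d univ (p k.succ) - IntervalOpt.sl d univ (p k.castSucc) := by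
  have h1 := lt_cst_sub_of_dominant d v ε (hdom k.castSucc) (hdom k.succ).1 (hne k).symm
  have h2 := cst_sub_lt_of_dominant d v ε (hdom k.succ) (hdom k.castSucc).1 (hne k)
  have hθk : θ k.castSucc < θ k.succ := hθ k.castSucc_lt_succ
  by_contra hle
  push Not at hle
  have h3 : θ k.succ * (IntervalOpt.sl d univ (p k.succ) - IntervalOpt.sl d univ (p k.castSucc)) ≤
      θ k.castSucc * (IntervalOpt.sl d univ (p k.succ) - IntervalOpt.sl d univ (p k.castSucc)) :=
    mul_le_mul_of_nonpos_right hθk.le hle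
  linarith

/-- **Edge slopes of the Newton polygon strictly increase** (design-level, `Fin`-indexed): for steps `k < k'` of a dominant chain,
`Δcst k · Δsl k' < Δcst k' · Δsl k`. [folklore] -/
theorem ratchet {n : ℕ} (θ : Fin (n + 1) → ℤ) (p : Fin (n + 1) → Equiv.Perm (Fin m) × (Fin m → Fin K))
    (hθ : StrictMono θ) (hdom : ∀ k, IsDominant d v ε (θ k) (p k)) (hne : ∀ k : Fin n, p k.castSucc ≠ p k.succ)
    {k k' : Fin n} (hkk' : k < k') :
    (IntervalOpt.cst v univ (p k.succ) - IntervalOpt.cst v univ (p k.castSucc)) *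
        (IntervalOpt.sl d univ (p k'.succ) - IntervalOpt.sl d univ (p k'.castSucc)) <
      (IntervalOpt.cst v univ (p k'.succ) - IntervalOpt.cst v univ (p k'.castSucc)) *
        (IntervalOpt.sl d univ (p k.succ) - IntervalOpt.sl d univ (p k.castSucc)) := by
  -- upper sandwich at step `k`, lower sandwich at step `k'`
  have hk2 := cst_sub_lt_of_dominant d v ε (hdom k.succ) (hdom k.castSucc).1 (hne k)
  have hk'1 := lt_cst_sub_of_dominant d v ε (hdom k'.castSucc) (hdom k'.succ).1 (hne k').symm
  have ha := sl_step_pos d v ε θ p hθ hdom hne k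
  have hb := sl_step_pos d v ε θ p hθ hdom hne k'
  -- `θ k.succ ≤ θ k'.castSucc` since `k.succ ≤ k'.castSucc`
  have hθ' : θ k.succ ≤ θ k'.castSucc := by
    apply hθ.monotone
    rw [Fin.le_def, Fin.val_succ, Fin.val_castSucc]
    exact Nat.succ_le_of_lt (Fin.lt_def.1 hkk')
  calc (IntervalOpt.cst v univ (p k.succ) - IntervalOpt.cst v univ (p k.castSucc)) *
        (IntervalOpt.sl d univ (p k'.succ) - IntervalOpt.sl d univ (p k'.castSucc))
      < θ k.succ * (IntervalOpt.sl d univ (p k.succ) - IntervalOpt.sl d univ (p k.castSucc)) *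
        (IntervalOpt.sl d univ (p k'.succ) - IntervalOpt.sl d univ (p k'.castSucc)) := mul_lt_mul_of_pos_right hk2 hb
    _ ≤ θ k'.castSucc * (IntervalOpt.sl d univ (p k.succ) - IntervalOpt.sl d univ (p k.castSucc)) *
        (IntervalOpt.sl d univ (p k'.succ) - IntervalOpt.sl d univ (p k'.castSucc)) := by
          rw [mul_assoc, mul_assoc]
          exact mul_le_mul_of_nonneg_right hθ' (mul_pos ha hb).le
    _ = θ k'.castSucc * (IntervalOpt.sl d univ (p k'.succ) - IntervalOpt.sl d univ (p k'.castSucc)) *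
        (IntervalOpt.sl d univ (p k.succ) - IntervalOpt.sl d univ (p k.castSucc)) := by ring
    _ < (IntervalOpt.cst v univ (p k'.succ) - IntervalOpt.cst v univ (p k'.castSucc)) *
        (IntervalOpt.sl d univ (p k.succ) - IntervalOpt.sl d univ (p k.castSucc)) := mul_lt_mul_of_pos_right hk'1 ha

/-- **RATCHET law.**  Two steps `k < k'` of a dominant chain with the SAME slope increment have strictly increasing valuation
increments: `Δcst k < Δcst k'`.  (E.g. the unit steps of the fastest digit of a scale-separated design, or the class switches of one
type `(l, l')`: their prices `v e l' − v e l` strictly increase along the whole chain, across every carry.) [folklore] -/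
theorem ratchet_of_sl_eq {n : ℕ} (θ : Fin (n + 1) → ℤ) (p : Fin (n + 1) → Equiv.Perm (Fin m) × (Fin m → Fin K))
    (hθ : StrictMono θ) (hdom : ∀ k, IsDominant d v ε (θ k) (p k)) (hne : ∀ k : Fin n, p k.castSucc ≠ p k.succ)
    {k k' : Fin n} (hkk' : k < k')
    (hs : IntervalOpt.sl d univ (p k.succ) - IntervalOpt.sl d univ (p k.castSucc) =
      IntervalOpt.sl d univ (p k'.succ) - IntervalOpt.sl d univ (p k'.castSucc)) :
    IntervalOpt.cst v univ (p k.succ) - IntervalOpt.cst v univ (p k.castSucc) <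
      IntervalOpt.cst v univ (p k'.succ) - IntervalOpt.cst v univ (p k'.castSucc) := by
  have h := ratchet d v ε θ p hθ hdom hne hkk'
  have ha := sl_step_pos d v ε θ p hθ hdom hne k
  rw [← hs] at h
  exact lt_of_mul_lt_mul_right h ha.le

/-- **Distinct steps have distinct edge vectors** `(Δsl, Δcst)` (design-level `edge_injOn`; in particular no labelled exchange and no
priced class switch recurs). [folklore] -/
theorem step_ne {n : ℕ} (θ : Fin (n + 1) → ℤ) (p : Fin (n + 1) → Equiv.Perm (Fin m) × (Fin m → Fin K))
    (hθ : StrictMono θ) (hdom : ∀ k, IsDominant d v ε (θ k) (p k)) (hne : ∀ k : Fin n, p k.castSucc ≠ p k.succ)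
    {k k' : Fin n} (hkk' : k ≠ k') :
    (IntervalOpt.sl d univ (p k.succ) - IntervalOpt.sl d univ (p k.castSucc),
        IntervalOpt.cst v univ (p k.succ) - IntervalOpt.cst v univ (p k.castSucc)) ≠
      (IntervalOpt.sl d univ (p k'.succ) - IntervalOpt.sl d univ (p k'.castSucc),
        IntervalOpt.cst v univ (p k'.succ) - IntervalOpt.cst v univ (p k'.castSucc)) := by
  intro h
  simp only [Prod.mk.injEq] at h
  obtain ⟨hs, hc⟩ := h
  rcases lt_or_gt_of_ne hkk' with hlt | hlt
  · have := ratchet_of_sl_eq d v ε θ p hθ hdom hne hlt hs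
    rw [hc] at this
    exact lt_irrefl _ this
  · have := ratchet_of_sl_eq d v ε θ p hθ hdom hne hlt hs.symm
    rw [hc] at this
    exact lt_irrefl _ this

end NewtonPolygon

end Summit.ValiantsHypothesis.ValiantsHypothesis.Theorems.KPlusLogSqLaw
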